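import Mathlib
import Literature.Analysis.FluidPDE.SuitableWeak
import Literature.Analysis.FluidPDE.ClassicalSuitable
import Literature.Analysis.FluidPDE.Seregin2020ScaledEnergyBoundsA
import Summits.NavierStokesRegularity.NavierStokesRegularity.Theorems.LandauTailLandauTailBlowupNotTypeI

/-!
# Suitable Landau-tailed witnesses are Type II in the energy quantity `A`: `limsup A(r) = ∞`

Helper file for crux `LandauTailBlowup` (stmt-NavierStokesRegularity-1944), line `registered`,
registered stub `landauTail_limsup_cknA_eq_top_of_suitable` (W7) of lead cycle c7.

Let `(u, p)` be a classical unit-viscosity solution of the unforced Navier–Stokes system on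
`ℝ³ × (−1, 0)` with the parabolic tail `√(−t) u(t, √(−t) y) → U y` (`y ≠ 0`) to a nonzero steady
`(−1)`-homogeneous profile `(U, P)` smooth off the origin (a witness of the body of `LandauTailLocal`),
which is moreover a *suitable weak solution* in the unit parabolic cylinder `Q₁(0,0) = (−1, 0) × B₁`
with finite dissipation `∫_{−1}^{0} ∫_{B₁} |∇u|² < ∞` and finite scaled pressure `D(1) < ∞` there.

Claim (W7).  The Caffarelli–Kohn–Nirenberg scaled energy `A(r) = sup_{−r² < t < 0} r⁻¹ ∫_{B_r} |u(t)|²`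
at the singular point is unbounded along `r → 0⁺`: `limsup_{r → 0⁺} A(r) = ∞`.

Proof.  Otherwise `limsup A < ∞`, and the case `A` of Seregin's remark "`g < ∞ ⇒ G < ∞`"
(`Seregin2020.scaledEnergies_bounded_of_limsup_cknA_lt_top`: Seregin 2020, remark after Def. 1.7;
Seregin 2014, §6.1), applied in `Q₁(0,0)` with the classical gradient `∇u = fderiv ℝ (u t) x` as the
weak spatial gradient (`hasWeakSpatialGradientOn_of_contDiffOn`) — its scaled dissipation `E(1)` is
the product-measure integral of `|∇u|²` over `(−1,0) × B₁`, at most the iterated one (Tonelli's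
inequality `lintegral_prod_le`), hence finite — bounds `A + E + C + D ≤ K` on some `]0, r₁]`.  But the
scaled cubic quantity diverges, `C(r) → ∞` (`landauTail_cknC_tendsto_top`, c6), so some `r ∈ ]0, r₁]`
has `K < C(r) ≤ (A + E + C + D)(r) ≤ K`, a contradiction.

References: G. Seregin, Anal. Math. Phys. 10 (2020), Paper 46, remark after Def. 1.7; G. Seregin,
*Lecture Notes on Regularity Theory for the Navier–Stokes Equations* (2014), §6.1; L. Caffarelli,
R. Kohn, L. Nirenberg, CPAM 35 (1982), §2.
-/

set_option linter.dupNamespace false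

namespace Summit.NavierStokesRegularity.NavierStokesRegularity.Theorems

open MeasureTheory Set Filter Topology Metric
open scoped ENNReal NNReal
open Literature.Analysis.FluidPDE

/-- The unit backward parabolic cylinder at the space–time origin is the product
`(−1, 0) × B₁`. [folklore] -/
theorem landauTail_typeIIA_parabolicCylinder_one :
    parabolicCylinder 1 ((0 : ℝ), (0 : EuclideanSpace ℝ (Fin 3))) =
      Ioo (-1 : ℝ) 0 ×ˢ ball (0 : EuclideanSpace ℝ (Fin 3)) 1 := by
  simp only [parabolicCylinder, one_pow, zero_sub]

/-- **Tonelli's inequality for the unit scaled dissipation**: with the classical gradient,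
`cknE 1 (0,0) ∇u ≤ ∫_{−1}^{0} ∫_{B₁} |∇u|²` (product-measure integral `≤` iterated integral,
no measurability needed). [folklore] -/
theorem landauTail_typeIIA_cknE_one_le
    (u : ℝ → EuclideanSpace ℝ (Fin 3) → EuclideanSpace ℝ (Fin 3)) :
    cknE 1 ((0 : ℝ), (0 : EuclideanSpace ℝ (Fin 3))) (fun t x => fderiv ℝ (u t) x) ≤
      ∫⁻ t in Ioo (-1 : ℝ) 0, ∫⁻ x in ball (0 : EuclideanSpace ℝ (Fin 3)) 1,
        ENNReal.ofReal (frobeniusNormSq (fderiv ℝ (u t) x)) := by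
  unfold cknE
  rw [ENNReal.ofReal_one, inv_one, one_mul, landauTail_typeIIA_parabolicCylinder_one,
    Measure.volume_eq_prod, ← Measure.prod_restrict]
  exact lintegral_prod_le _

/-- **W7 — suitable Landau-tailed witnesses have `limsup_{r→0⁺} A(r) = ∞`** (Seregin's triple
`A, C, E` completed: c6 proved `C(r) → ∞` and `E(r) → ∞`).  For every Landau-tailed local classical
solution which is a suitable weak solution in `Q₁(0,0)` with `∫_{−1}^{0}∫_{B₁} |∇u|² < ∞` and
`D(1) < ∞`, the CKN scaled energy at the singular point satisfies `limsup_{r → 0⁺} cknA r (0,0) u = ⊤`: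
otherwise Seregin's bound (`Seregin2020.scaledEnergies_bounded_of_limsup_cknA_lt_top`, with the
classical gradient as weak gradient and `E(1) < ∞` by Tonelli) gives `A + E + C + D ≤ K` near `0`,
contradicting `C(r) → ∞` (`landauTail_cknC_tendsto_top`).
[cite: Seregin2020, remark after Def. 1.7] -/
theorem landauTail_limsup_cknA_eq_top_of_suitable : ∀ (u : ℝ → EuclideanSpace ℝ (Fin 3) → EuclideanSpace ℝ (Fin 3)) (p : ℝ → EuclideanSpace ℝ (Fin 3) → ℝ) (U : EuclideanSpace ℝ (Fin 3) → EuclideanSpace ℝ (Fin 3)) (P : EuclideanSpace ℝ (Fin 3) → ℝ), (ContDiffOn ℝ (⊤ : ℕ∞) U {0}ᶜ ∧ ContDiffOn ℝ (⊤ : ℕ∞) P {0}ᶜ ∧ (∀ x : EuclideanSpace ℝ (Fin 3), x ≠ 0 → Literature.Analysis.FluidPDE.convect U U x + gradient P x = (1 : ℝ) • Laplacian.laplacian U x) ∧ (∀ x : EuclideanSpace ℝ (Fin 3), x ≠ 0 → Literature.Analysis.FluidPDE.VectorCalculus.divergence U x = 0) ∧ (∀ c : ℝ, 0 < c → ∀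 x : EuclideanSpace ℝ (Fin 3), U (c • x) = c⁻¹ • U x) ∧ (∃ x : EuclideanSpace ℝ (Fin 3), U x ≠ 0)) → Literature.Analysis.FluidPDE.IsClassicalNSSolutionOn (Set.Ioo (-1) 0) 1 0 u p → (∫⁻ t in Set.Ioo (-1 : ℝ) 0, ∫⁻ x in Metric.ball (0 : EuclideanSpace ℝ (Fin 3)) 1, ENNReal.ofReal (Literature.Analysis.FluidPDE.frobeniusNormSq (fderiv ℝ (u t) x)) < ⊤) → (∀ y : EuclideanSpace ℝ (Fin 3), y ≠ 0 → Filter.Tendsto (fun t : ℝ => Real.sqrt (0 - t) • u t (Real.sqrt (0 - t) • y)) (nhdsWithin 0 (Set.Iio 0)) (nhds (U y))) → Literature.Analysis.FluidPDE.IsSuitableWeakSolutionOn (Literature.Analysis.FluidPDE.parabolicCylinderOpens 1 ((0 : ℝ), (0 : EuclideanSpace ℝ (Fin 3)))) 1 0 u p → Literature.Analysis.FluidPDE.cknD 1 ((0 : ℝ), (0 : EuclideanSpace ℝ (Fin 3))) p ≠ ⊤ → Filter.limsup (fun r : ℝ => Literature.Analysis.FluidPDE.cknA r ((0 : ℝ),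 (0 : EuclideanSpace ℝ (Fin 3))) u) (nhdsWithin 0 (Set.Ioi 0)) = ⊤ := by
  intro u p U P hprof hcl hfin htail hsw hD
  by_contra hA
  have hA' : limsup (fun r : ℝ => cknA r ((0 : ℝ), (0 : EuclideanSpace ℝ (Fin 3))) u)
      (𝓝[>] 0) < ⊤ := lt_top_iff_ne_top.2 hA
  -- the classical gradient is a weak spatial gradient on `Q₁(0,0) ⊆ (−1,0) × ℝ³`
  have hS : IsOpen (Ioo (-1 : ℝ) 0) := isOpen_Ioo
  have hQS : ((parabolicCylinderOpens 1 ((0 : ℝ), (0 : EuclideanSpace ℝ (Fin 3))) :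
      TopologicalSpace.Opens (ℝ × EuclideanSpace ℝ (Fin 3))) :
        Set (ℝ × EuclideanSpace ℝ (Fin 3))) ⊆ Ioo (-1 : ℝ) 0 ×ˢ univ := by
    rw [coe_parabolicCylinderOpens, landauTail_typeIIA_parabolicCylinder_one]
    exact prod_mono subset_rfl (subset_univ _)
  have hu1 : ContDiffOn ℝ 1 (Function.uncurry u) (Ioo (-1 : ℝ) 0 ×ˢ univ) :=
    hcl.smooth_velocity.of_le (by exact_mod_cast le_top)
  have hG : HasWeakSpatialGradientOn
      (parabolicCylinderOpens 1 ((0 : ℝ), (0 : EuclideanSpace ℝ (Fin 3)))) u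
      (fun t x => fderiv ℝ (u t) x) :=
    hasWeakSpatialGradientOn_of_contDiffOn hS hQS hu1
  -- finite unit scaled dissipation (Tonelli) and Seregin's bound
  have hE₀ : cknE 1 ((0 : ℝ), (0 : EuclideanSpace ℝ (Fin 3))) (fun t x => fderiv ℝ (u t) x) ≠ ⊤ :=
    ((landauTail_typeIIA_cknE_one_le u).trans_lt hfin).ne
  have hQ : parabolicCylinder 1 ((0 : ℝ), (0 : EuclideanSpace ℝ (Fin 3))) ⊆
      ((parabolicCylinderOpens 1 ((0 : ℝ), (0 : EuclideanSpace ℝ (Fin 3))) :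
        TopologicalSpace.Opens (ℝ × EuclideanSpace ℝ (Fin 3))) :
          Set (ℝ × EuclideanSpace ℝ (Fin 3))) := by
    rw [coe_parabolicCylinderOpens]
  obtain ⟨K, r₁, hr₁, hK⟩ :=
    Seregin2020.scaledEnergies_bounded_of_limsup_cknA_lt_top hsw hG one_pos hQ hE₀ hD hA'
  -- but `C(r) → ∞`
  have hC := landauTail_cknC_tendsto_top u p U P hprof hcl htail
  rw [ENNReal.tendsto_nhds_top_iff_nnreal] at hC
  obtain ⟨r, hKr, hr⟩ := ((hC K).and (Ioc_mem_nhdsGT hr₁)).exists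
  have hle : cknC r ((0 : ℝ), (0 : EuclideanSpace ℝ (Fin 3))) u ≤ K :=
    (le_add_self.trans le_self_add).trans (hK r hr)
  exact absurd hKr (not_lt.2 hle)

end Summit.NavierStokesRegularity.NavierStokesRegularity.Theorems
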